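import Mathlib.RingTheory.MvPolynomial.WeightedHomogeneous
import Literature.Computability.AlgebraicComplexity.DeterminantalComplexity
import Literature.Computability.AlgebraicComplexity.DeterminantalComplexityProofs
import Literature.Computability.AlgebraicComplexity.LinSubstProofs
import Literature.Computability.AlgebraicComplexity.VPDeterminantalQPProofs
import Summits.ValiantsHypothesis.ValiantsHypothesis.Theorems.BorderApolarityFixedWitnessObstructionQPInterp
import Summits.ValiantsHypothesis.ValiantsHypothesis.Theorems.BorderApolarityFixedWitnessObstructionQPInvReprOfDetRepr

/-!
# Border apolarity, crux `FixedWitnessObstructionQP` — de-bordering of bounded-weight components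

Route `ValiantsHypothesis/BorderApolarity`, crux item `stmt-ValiantsHypothesis-5778`, line
`toric-face-debordering`: the sorry-free ASSEMBLY of the planner's `stub_deborder` over the two landed
stubs `stub_interp` (Vandermonde interpolation of weighted-homogeneous components by torus substitutes,
`…QPInterp.lean`) and `stub_invReprOfDetRepr` (a homogeneous polynomial with an affine determinantal
expression of size `s` is an inverse read-out `vᵀ B⁻¹ w`, `det B = 1`, of size `≤ 2 (s+1)^9`,
`…QPInvReprOfDetRepr.lean`), plus two small closure facts of independent use:

* `hasDetRepr_linSubst` — affine determinantal expressions are stable under ANY linear substitution of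
  the variables (same size);
* `hasInvRepr_smul` — inverse read-outs are stable under scalars (same size);
* `hasDetRepr_weightedHomogeneousComponent_linSubst` — **de-bordering**: if `f` is homogeneous of degree
  `d` with `HasDetRepr f s` and `w ≤ B` pointwise, then every weighted-homogeneous component
  `wHC_w^e (A · f)` has an affine determinantal expression of size `3 ((s+1)(B+1))^10`
  (interpolate at `sB + 1` nodes, each node an inverse read-out of size `2(s+1)^9`, add them
  block-diagonally — `HasInvRepr.finset_sum` — and border the matrix, `HasInvRepr.hasDetRepr`);
* `stub_deborder` — the same with the constants packaged as `∃ C e₀` (the planner's registered stub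
  `stub_deborder` of `Cruxes/FixedWitnessObstructionQP/Lines/toric-face-debordering.lean`, verbatim);
* `hasDetRepr_sum_of_isHomogeneous` — **polynomial sub-additivity of determinantal complexity for forms**:
  a sum of `K` homogeneous degree-`d` polynomials each with `HasDetRepr · s` has `HasDetRepr` of size
  `K · 2(s+1)^9 + 1`.

These are the "border + torus weights cost at most a polynomial factor" half of the line; the per/det
asymmetry of the crux lives elsewhere (external eventual dc-thesis). Printed ancestors: Bürgisser 2004
(arXiv:cs/0212057) Lemma 5.5(3) and Prop. 5.4 (interpolation de-bordering for circuits), Valiant 1979 /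
Bürgisser–Clausen–Shokrollahi 1997 Thm (21.27) (sums of determinants via branching programs),
Ikenmeyer–Landsberg 2017 Thm 4.1 (determinant ⇒ power trace).
-/

open MvPolynomial
open scoped BigOperators Matrix
open Literature.Computability.AlgebraicComplexity

namespace Summit.ValiantsHypothesis.ValiantsHypothesis.Theorems.BorderApolarityFixedWitnessObstructionQP

/-- Affine determinantal expressions are stable under linear substitution of the variables: apply the
algebra endomorphism `linSubst A` entrywise (`RingHom.map_det`); affine entries stay affine
(`totalDegree_linSubst_le_holds`). Any square `A`, invertible or not. [folklore] -/
theorem hasDetRepr_linSubst {σ : Type*} [Fintype σ] (A : Matrix σ σ ℂ) {f : MvPolynomial σ ℂ} {s : ℕ}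
    (h : HasDetRepr f s) : HasDetRepr (linSubst σ ℂ A f) s := by
  obtain ⟨M, hM1, hMdet⟩ := h
  refine ⟨(linSubst σ ℂ A).toRingHom.mapMatrix M, fun i j => ?_, ?_⟩
  · exact (totalDegree_linSubst_le_holds A (M i j)).trans (hM1 i j)
  · rw [← RingHom.map_det, hMdet]
    rfl

/-- Inverse read-outs are stable under scalars: scale the read-out vector `v`. [folklore] -/
theorem hasInvRepr_smul {σ : Type*} (c : ℂ) {g : MvPolynomial σ ℂ} {m : ℕ} (h : HasInvRepr g m) :
    HasInvRepr (c • g) m := by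
  obtain ⟨ι, _, _, B, v, w, hc, hB, hd, hg⟩ := h
  refine ⟨ι, inferInstance, inferInstance, B, fun i => c * v i, w, hc, hB, hd, ?_⟩
  rw [← hg]
  simp only [dotProduct, map_mul, Finset.smul_sum, MvPolynomial.smul_eq_C_mul, mul_assoc]

/-- **Polynomial sub-additivity of determinantal complexity for forms.** A sum of `K` homogeneous
polynomials of the same degree `d`, each with an affine determinantal expression of size `s`, has one of
size `K · 2(s+1)^9 + 1` (inverse read-outs of size `2(s+1)^9` each, `stub_invReprOfDetRepr`; sizes add
under sums, `HasInvRepr.finset_sum`; border, `HasInvRepr.hasDetRepr`). [folklore] -/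
theorem hasDetRepr_sum_of_isHomogeneous {σ : Type} [Fintype σ] [DecidableEq σ] {ι : Type*}
    (T : Finset ι) (p : ι → MvPolynomial σ ℂ) (d s : ℕ)
    (hhom : ∀ i ∈ T, (p i).IsHomogeneous d) (hdet : ∀ i ∈ T, HasDetRepr (p i) s) :
    HasDetRepr (∑ i ∈ T, p i) (T.card * (2 * (s + 1) ^ 9) + 1) :=
  (HasInvRepr.finset_sum T (fun i hi =>
    stub_invReprOfDetRepr σ (p i) d s (hhom i hi) (hdet i hi))).hasDetRepr

/-- **De-bordering of bounded-weight components, explicit constants.** If `f` is homogeneous of degree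
`d` with an affine determinantal expression of size `s`, and the weight `w` is bounded by `B`, then for
every square matrix `A` and every weight value `e` the weighted-homogeneous component
`wHC_w^e (A · f)` has an affine determinantal expression of size `3 ((s+1)(B+1))^10`.
Proof: `g := A · f` is homogeneous of degree `d` with `HasDetRepr g s` (`hasDetRepr_linSubst`); its
monomials have `w`-weight `≤ d B ≤ s B` (`d ≤ s` unless `g = 0`); `stub_interp` writes the component
as `Σ_{j ≤ sB} c_j · diag((j+1)^w) · g`, each summand an inverse read-out of size `2(s+1)^9`
(`stub_invReprOfDetRepr`, `hasInvRepr_smul`), and `(sB+1) · 2(s+1)^9 + 1 ≤ 3((s+1)(B+1))^10`.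
[folklore] -/
theorem hasDetRepr_weightedHomogeneousComponent_linSubst {σ : Type} [Fintype σ] [DecidableEq σ]
    (s B d : ℕ) (w : σ → ℕ) (e : ℕ) (f : MvPolynomial σ ℂ) (A : Matrix σ σ ℂ)
    (hf : f.IsHomogeneous d) (hdet : HasDetRepr f s) (hw : ∀ i, w i ≤ B) :
    HasDetRepr (MvPolynomial.weightedHomogeneousComponent w e (linSubst σ ℂ A f))
      (3 * ((s + 1) * (B + 1)) ^ 10) := by
  -- the translate `g = A · f`: homogeneous of degree `d`, determinantal of size `s`
  have hghom : (linSubst σ ℂ A f).IsHomogeneous d := linSubst_isHomogeneous A hf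
  have hgdet : HasDetRepr (linSubst σ ℂ A f) s := hasDetRepr_linSubst A hdet
  -- weights on its support are at most `s * B`
  have hwt : ∀ α ∈ (linSubst σ ℂ A f).support, Finsupp.weight w α ≤ s * B := by
    intro α hα
    have hne : linSubst σ ℂ A f ≠ 0 :=
      MvPolynomial.ne_zero_iff.mpr ⟨α, MvPolynomial.mem_support_iff.mp hα⟩
    have hdeg : Finsupp.weight (1 : σ → ℕ) α = d := hghom (MvPolynomial.mem_support_iff.mp hα)
    have hw1 : Finsupp.weight (1 : σ → ℕ) α = ∑ i ∈ α.support, α i := by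
      rw [Finsupp.weight_apply, Finsupp.sum]
      simp only [Pi.one_apply, smul_eq_mul, mul_one]
    have hds : d ≤ s := by
      have h1 := hghom.totalDegree hne
      have h2 := totalDegree_le_of_hasDetRepr_holds hgdet
      omega
    calc Finsupp.weight w α = ∑ i ∈ α.support, α i • w i := by
          rw [Finsupp.weight_apply, Finsupp.sum]
      _ ≤ ∑ i ∈ α.support, α i * B := Finset.sum_le_sum fun i _ => by
          rw [smul_eq_mul]; exact Nat.mul_le_mul_left _ (hw i)
      _ = (∑ i ∈ α.support, α i) * B := by rw [Finset.sum_mul]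
      _ = d * B := by rw [← hw1, hdeg]
      _ ≤ s * B := Nat.mul_le_mul_right _ hds
  -- interpolation
  obtain ⟨c, hc⟩ := stub_interp σ w (s * B) e (linSubst σ ℂ A f) hwt
  -- each node is an inverse read-out of size `2 (s+1)^9`
  have hnode : ∀ j : Fin (s * B + 1), HasInvRepr
      (c j • linSubst σ ℂ (Matrix.diagonal fun i => (((j : ℕ) : ℂ) + 1) ^ (w i)) (linSubst σ ℂ A f))
      (2 * (s + 1) ^ 9) := fun j =>
    hasInvRepr_smul (c j) (stub_invReprOfDetRepr σ _ d s (linSubst_isHomogeneous _ hghom)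
      (hasDetRepr_linSubst _ hgdet))
  have hsum := HasInvRepr.finset_sum (Finset.univ : Finset (Fin (s * B + 1))) (fun j _ => hnode j)
  rw [← hc, Finset.card_univ, Fintype.card_fin] at hsum
  refine HasDetRepr.mono_holds hsum.hasDetRepr ?_
  -- `(sB+1) · 2(s+1)^9 + 1 ≤ 3 ((s+1)(B+1))^10`
  have hP : 1 ≤ (s + 1) * (B + 1) := Nat.one_le_iff_ne_zero.mpr (by positivity)
  have h1 : s * B + 1 ≤ (s + 1) * (B + 1) := by nlinarith
  have h2 : (s + 1) ^ 9 ≤ ((s + 1) * (B + 1)) ^ 9 :=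
    Nat.pow_le_pow_left (Nat.le_mul_of_pos_right _ (by omega)) 9
  have h3 : 1 ≤ ((s + 1) * (B + 1)) ^ 10 := Nat.one_le_pow _ _ hP
  calc (s * B + 1) * (2 * (s + 1) ^ 9) + 1
      ≤ (s + 1) * (B + 1) * (2 * ((s + 1) * (B + 1)) ^ 9) + 1 :=
        Nat.add_le_add_right (Nat.mul_le_mul h1 (Nat.mul_le_mul_left 2 h2)) 1
    _ = 2 * ((s + 1) * (B + 1)) ^ 10 + 1 := by ring
    _ ≤ 3 * ((s + 1) * (B + 1)) ^ 10 := by omega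

/-- **De-bordering of bounded-weight components** (the shape registered as `stub_deborder` by the planner
of line `toric-face-debordering`, with `C = 3`, `e₀ = 10`): universal constants `C, e₀` such that for every
finite variable set, every homogeneous `f` of degree `d` with `HasDetRepr f s`, every weight `w ≤ B`, every
square matrix `A` and every `e`, `wHC_w^e (A · f)` has an affine determinantal expression of size
`C ((s+1)(B+1))^e₀`. [folklore] -/
theorem stub_deborder : ∃ C e₀ : ℕ, ∀ (σ : Type) [Fintype σ] [DecidableEq σ] (s B d : ℕ) (w : σ → ℕ)
    (e : ℕ) (f : MvPolynomial σ ℂ) (A : Matrix σ σ ℂ), f.IsHomogeneous d → HasDetRepr f s →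
      (∀ i, w i ≤ B) →
      HasDetRepr (MvPolynomial.weightedHomogeneousComponent w e (linSubst σ ℂ A f))
        (C * ((s + 1) * (B + 1)) ^ e₀) :=
  ⟨3, 10, fun _ _ _ s B d w e f A hf hdet hw =>
    hasDetRepr_weightedHomogeneousComponent_linSubst s B d w e f A hf hdet hw⟩

end Summit.ValiantsHypothesis.ValiantsHypothesis.Theorems.BorderApolarityFixedWitnessObstructionQP
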